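import Literature.NumberTheory.EllipticCurves.LocalWeilPairingDuality
import Literature.NumberTheory.GaloisRepresentations.InertiaCohomologyFinite
import Literature.NumberTheory.GaloisRepresentations.FrobeniusOnTameInertiaImage
import HarnessLib

/-!
# Local lemmas for the tame cup-product shape: homomorphisms for a trivial action, Frobenius
# generation, a tame generator, and the additive Weil pairing
# (cell `b2b-bsdres`, team x11b3 = N8/O2, seat p3 GEN 10, (P3-B) FILE 1b-i)

HONEST FRAMING (cell `b2b-bsdres`, run/shared/lean/b2b/bsd-rank1-residual/, verbatim in every
file): the goal of the cell is to DELETE the COMBINATION-SHAPED residual classes of the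
Birch–Swinnerton-Dyer formula for ALL analytic-rank `≤ 1` elliptic curves over `ℚ` — "full BSD
formula for every rank `≤ 1` curve in class `C`" assembled STRICTLY from published theorems — so
that the rank-`≤ 1` remainder becomes exactly the CONSTRUCTION-SHAPED classes, which are TYPED
(missing-input `Prop`s), NOT attempted. This is not "finishing BSD". Team N8/O2 = `x11b3`, seat
`b2b-bsdres-x11b3-p3` GEN 10, lead deal R10-65 (P3-B): plumbing / debt reduction on the PUBLISHED
Kolyvagin finiteness theorem (Gross 1991, Thm. 1.3 (2)) — the road to leaf (B) = Kolyvagin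
reciprocity (R)_M from Poitou–Tate. THEOREMS ONLY (no definition, no named fact, no `sorry`);
TOOL theorems of local Galois cohomology for a non-archimedean local field `F`; nothing
`p = 3`-specific; nothing is booked; no mark / label / count is changed.

## Content (consumed by `X11b/TameCupProductShape.lean`)

* §1 For a `Γ`-module with TRIVIAL action, continuous crossed homomorphisms are homomorphisms:
  cohomologous ones are equal (`apply_eq_of_oneCocycleClass_eq`), `φ(gh) = φ g + φ h`, powers,
  inverses, and the packaging as `Γ →* Multiplicative X`.
* §2 Over a non-archimedean local field `F`, for a discrete `Γ_F`-module `M` with trivial action: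
  `exists_apply_eq_zsmul_apply_frob` — a crossed homomorphism vanishing on the inertia group `I_F`
  takes only the values `k • φ(Frob)` (`Γ_F / I_F` is topologically generated by an arithmetic
  Frobenius; tree `exists_eq_frob_zpow_mul_of_isOpen_ker`); `exists_tame_generator` — for finitely
  many crossed homomorphisms and `#M` prime to the residue characteristic there is ONE `s₁ ∈ I_F`
  with `φ(t) ∈ ℕ • φ(s₁)` for all `t ∈ I_F` (tame quotients of `I_F` of exponent prime to `p` are
  cyclic: tree `exists_subgroup_forall_eq_coboundary`, Serre *Local Fields* IV §2).
* §3 The additive Weil pairing `weilPairingHom` of a `μₙ`-valued pairing `e` on `E[n]`: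
  `weilPairingHom e S T = 0 ↔ e S T = 1`, and alternating + right-non-degenerate ⟹ trivial left
  kernel.

References (locators only; no cited FACT): [cite: SerreLocalFields1979, Ch. IV §2 (Cor. 1 and
Cor. 3 of Prop. 7); Ch. XIII §1] [cite: GrossLMS1991, §7 Prop. 7.5 (proof: "the homomorphism …
must kill the wild inertia subgroup … and factor through the maximal pro-`p` quotient of the tame
inertia group", PDF p. 225)] [cite: SilvermanAEC2009, Prop. III.8.1].

## Design

No definitions, no local instances; namespace `Summit.BirchSwinnertonDyer.Rank1Residual.X11b.TameCup`.
Axioms: `propext`, `Classical.choice`, `Quot.sound`.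
-/

noncomputable section

open scoped Classical

universe u

namespace Summit.BirchSwinnertonDyer.Rank1Residual.X11b.TameCup

open CategoryTheory WeierstrassCurve Field Function ValuativeRel
open Literature.NumberTheory.EllipticCurves
open Literature.NumberTheory.GaloisRepresentations
open Literature.NumberTheory.GaloisRepresentations.IsNonarchimedeanLocalField
open Literature.NumberTheory.GaloisRepresentations.DiscreteGaloisModule (mu MuCarrier)
open _root_.TopRep _root_.ContinuousCohomology
open scoped ContRepresentation


/-! ## §1 Crossed homomorphisms for a TRIVIAL action are homomorphisms -/

section Trivial

variable {Γ : Type u} [Group Γ] [TopologicalSpace Γ]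
variable {X : TopRep.{u} ℤ Γ}

/-- For a trivial action, cohomologous continuous crossed homomorphisms are EQUAL pointwise
(a coboundary `g ↦ g v - v` vanishes). [folklore] -/
theorem apply_eq_of_oneCocycleClass_eq [IsTopologicalGroup Γ] (htriv : ∀ (g : Γ) (x : X), X.ρ g x = x)
    {φ ψ : contOneCocycles X} (h : oneCocycleClass X φ = oneCocycleClass X ψ) (g : Γ) :
    φ.1 g = ψ.1 g := by
  have h0 : oneCocycleClass X (φ - ψ) = 0 := by rw [oneCocycleClass_sub, h, sub_self]
  obtain ⟨v, hv⟩ := (oneCocycleClass_eq_zero_iff X (φ - ψ)).mp h0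
  have h1 := hv g
  rw [htriv, sub_self] at h1
  exact sub_eq_zero.mp h1

/-- For a trivial action a continuous crossed homomorphism is multiplicative-to-additive:
`φ (g h) = φ g + φ h`. [folklore] -/
theorem apply_mul_of_triv (htriv : ∀ (g : Γ) (x : X), X.ρ g x = x) (φ : contOneCocycles X)
    (g h : Γ) : φ.1 (g * h) = φ.1 g + φ.1 h := by
  rw [φ.2 g h, htriv]

/-- `φ (g ^ k) = k • φ g` for a trivial action. [folklore] -/
theorem apply_pow_of_triv (htriv : ∀ (g : Γ) (x : X), X.ρ g x = x) (φ : contOneCocycles X)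
    (g : Γ) (k : ℕ) : φ.1 (g ^ k) = k • φ.1 g := by
  induction k with
  | zero => rw [pow_zero, contOneCocycles.apply_one, zero_smul]
  | succ k ih => rw [pow_succ, apply_mul_of_triv htriv, ih, succ_nsmul]

/-- `φ g⁻¹ = -φ g` for a trivial action. [folklore] -/
theorem apply_inv_of_triv (htriv : ∀ (g : Γ) (x : X), X.ρ g x = x) (φ : contOneCocycles X)
    (g : Γ) : φ.1 g⁻¹ = -φ.1 g := by
  have h := apply_mul_of_triv htriv φ g g⁻¹
  rw [mul_inv_cancel, contOneCocycles.apply_one] at h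
  exact (neg_eq_of_add_eq_zero_right h.symm).symm

/-- `φ (g ^ k) = k • φ g` for `k : ℤ` and a trivial action. [folklore] -/
theorem apply_zpow_of_triv (htriv : ∀ (g : Γ) (x : X), X.ρ g x = x) (φ : contOneCocycles X)
    (g : Γ) (k : ℤ) : φ.1 (g ^ k) = k • φ.1 g := by
  cases k with
  | ofNat k => rw [Int.ofNat_eq_natCast, zpow_natCast, apply_pow_of_triv htriv, natCast_zsmul]
  | negSucc k =>
    rw [zpow_negSucc, apply_inv_of_triv htriv, apply_pow_of_triv htriv, negSucc_zsmul]

/-- The crossed homomorphism as a monoid homomorphism `Γ →* Multiplicative X` (trivial action).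
[folklore] -/
theorem exists_monoidHom_of_triv (htriv : ∀ (g : Γ) (x : X), X.ρ g x = x) (φ : contOneCocycles X) :
    ∃ lam : Γ →* Multiplicative X, ∀ g, lam g = Multiplicative.ofAdd (φ.1 g) :=
  ⟨{ toFun := fun g => Multiplicative.ofAdd (φ.1 g)
     map_one' := by rw [contOneCocycles.apply_one]; rfl
     map_mul' := fun g h => by rw [apply_mul_of_triv htriv, ofAdd_add] }, fun _ => rfl⟩

end Trivial

/-! ## §2 Local structure: Frobenius generation and the tame generator -/

section LocalStructure

variable (F : Type u) [Field F] [ValuativeRel F] [TopologicalSpace F] [IsNonarchimedeanLocalField F]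
variable {M : Type u} [AddCommGroup M] [TopologicalSpace M] [DiscreteTopology M]

/-- **An unramified homomorphism is determined by its value at a Frobenius**: for a discrete
`Γ_F`-module with TRIVIAL action, a continuous crossed homomorphism `φ` (= homomorphism) vanishing
on the inertia group `I_F` and an arithmetic Frobenius `φ_F`, every value `φ g` is an integer
multiple of `φ φ_F` (`Γ_F / I_F` is topologically generated by Frobenius:
`exists_eq_frob_zpow_mul_of_isOpen_ker`). [cite: SerreLocalFields1979, Ch. IV §2] -/
theorem exists_apply_eq_zsmul_apply_frob (ρ : DiscreteGaloisModule F M)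
    (htriv : ∀ (g : absoluteGaloisGroup F) (m : M), ρ g m = m)
    (φ : contOneCocycles ρ.toTopRep) (hφ : ∀ t ∈ absInertia F, φ.1 t = 0)
    {frob : absoluteGaloisGroup F} (hfrob : IsAbsArithFrob frob) (g : absoluteGaloisGroup F) :
    ∃ k : ℤ, φ.1 g = k • φ.1 frob := by
  have htriv' : ∀ (g : absoluteGaloisGroup F) (x : ρ.toTopRep), ρ.toTopRep.ρ g x = x := htriv
  obtain ⟨lam, hlam⟩ := exists_monoidHom_of_triv htriv' φ
  have hopen : IsOpen ((lam.ker : Subgroup (absoluteGaloisGroup F)) : Set (absoluteGaloisGroup F)) := by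
    have hset : ((lam.ker : Subgroup (absoluteGaloisGroup F)) : Set (absoluteGaloisGroup F)) =
        φ.1 ⁻¹' {0} := by
      ext g
      simp only [SetLike.mem_coe, MonoidHom.mem_ker, hlam, Set.mem_preimage, Set.mem_singleton_iff]
      exact ⟨fun h => Multiplicative.ofAdd.injective h, fun h => by rw [h]; rfl⟩
    rw [hset]
    exact (isOpen_discrete _).preimage φ.1.continuous
  obtain ⟨k, ι, hι, hk⟩ := exists_eq_frob_zpow_mul_of_isOpen_ker lam hopen hfrob g
  refine ⟨k, ?_⟩
  apply Multiplicative.ofAdd.injective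
  rw [← hlam, hk, hlam, hlam, hφ ι hι, ofAdd_zero, mul_one, ← ofAdd_zsmul]

/-- **A tame generator for finitely many homomorphisms** (Serre, *Local Fields* IV §2: the tame
quotients of `I_F` of exponent prime to `p` are cyclic): for a discrete `Γ_F`-module `M` with
TRIVIAL action and `#M` prime to the residue characteristic, and a finite set `S` of continuous
crossed homomorphisms (= homomorphisms) `Γ_F → M`, there is `s₁ ∈ I_F` such that on `I_F` every
`φ ∈ S` takes only the values `k • φ s₁`. From the tree's
`exists_subgroup_forall_eq_coboundary` (`I_F = ⋃ s₁^k W` with every `φ|_W` a coboundary, i.e.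
zero). [cite: SerreLocalFields1979, Ch. IV §2 Cor. 1 and Cor. 3 of Prop. 7] -/
theorem exists_tame_generator [Finite M] (ρ : DiscreteGaloisModule F M)
    (htriv : ∀ (g : absoluteGaloisGroup F) (m : M), ρ g m = m)
    (hM : (Nat.card M).Coprime (ringChar 𝓀[F]))
    (S : Finset (contOneCocycles ρ.toTopRep)) :
    ∃ s₁ ∈ absInertia F, ∀ φ ∈ S, ∀ t ∈ absInertia F, ∃ k : ℕ, φ.1 t = k • φ.1 s₁ := by
  have htriv' : ∀ (g : absoluteGaloisGroup F) (x : ρ.toTopRep), ρ.toTopRep.ρ g x = x := htriv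
  -- restriction of cocycles to the inertia group
  let rI : contOneCocycles ρ.toTopRep →
      contOneCocycles ((ContinuousRep.restrict ρ (Literature.NumberTheory.GaloisRepresentations.subgroupIncl (absInertia F))).toTopRep) :=
    fun φ => contOneCocycles.pullback (Literature.NumberTheory.GaloisRepresentations.subgroupIncl (absInertia F))
      (Y := (ContinuousRep.restrict ρ (Literature.NumberTheory.GaloisRepresentations.subgroupIncl (absInertia F))).toTopRep)
      (TopRep.ofHom ⟨ContinuousLinearMap.id ℤ M, fun _ => rfl⟩) φ
  have hrI : ∀ (φ : contOneCocycles ρ.toTopRep) (w : absInertia F), (rI φ).1 w = φ.1 (w : absoluteGaloisGroup F) :=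
    fun _ _ => rfl
  obtain ⟨W₀, g, hgen, hcob⟩ :=
    exists_subgroup_forall_eq_coboundary F (ρ : ContinuousRep (absoluteGaloisGroup F) ℤ M) hM
      (S.image rI)
  refine ⟨(g : absoluteGaloisGroup F), g.2, fun φ hφ t ht => ?_⟩
  obtain ⟨b, hb⟩ := hcob (rI φ) (Finset.mem_image_of_mem rI hφ)
  have hW : ∀ w ∈ W₀, φ.1 (w : absoluteGaloisGroup F) = 0 := fun w hw => by
    rw [← hrI, hb w hw, htriv, sub_self]
  obtain ⟨k, hk⟩ := hgen ⟨t, ht⟩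
  refine ⟨k, ?_⟩
  have ht' : t = (g : absoluteGaloisGroup F) ^ k *
      (((g ^ k)⁻¹ * ⟨t, ht⟩ : absInertia F) : absoluteGaloisGroup F) := by
    rw [Subgroup.coe_mul, Subgroup.coe_inv, Subgroup.coe_pow, mul_inv_cancel_left]
  rw [ht', apply_mul_of_triv htriv', hW _ hk, add_zero, apply_pow_of_triv htriv']

end LocalStructure

/-! ## §3 The additive Weil pairing: zero set and left kernel -/

section Main

variable {K : Type u} [Field K] [CharZero K] (W : WeierstrassCurve K) (n : ℕ) [NeZero n] [W.IsElliptic]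
variable (e : geomTorsion W n → geomTorsion W n → AlgebraicClosure K)
  (hμ : ∀ S T, e S T ^ n = 1)
  (hadd₁ : ∀ S₁ S₂ T, e (S₁ + S₂) T = e S₁ T * e S₂ T)
  (hadd₂ : ∀ S T₁ T₂, e S (T₁ + T₂) = e S T₁ * e S T₂)
variable (F : Type u) [Field F] [Algebra K F] [CharZero F] [ValuativeRel F] [TopologicalSpace F]
  [IsNonarchimedeanLocalField F]

omit [CharZero K] [W.IsElliptic] in
/-- `weilPairingHom e S T = 0 ↔ e S T = 1` (the additive packaging of a `μₙ`-valued pairing).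
[folklore] -/
theorem weilPairingHom_eq_zero_iff (S T : geomTorsion W n) :
    weilPairingHom W n e hμ hadd₁ hadd₂ S T = 0 ↔ e S T = 1 := by
  rw [muCarrier_eq_iff, coe_weilPairingHom]
  rfl

omit [CharZero K] [W.IsElliptic] in
/-- An alternating pairing with trivial right kernel has trivial left kernel (additive form:
`W y x = -W x y`). [folklore] -/
theorem weilPairingHom_left_nondeg (halt : ∀ T, e T T = 1) (hnondeg : ∀ T, (∀ S, e S T = 1) → T = 0)
    (x : geomTorsion W n) (hx : ∀ y, weilPairingHom W n e hμ hadd₁ hadd₂ x y = 0) : x = 0 := by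
  apply hnondeg x
  intro y
  rw [← weilPairingHom_eq_zero_iff W n e hμ hadd₁ hadd₂]
  -- skew-symmetry from alternation: `W y x = -W x y`
  have h := weilPairingHom_self W n e hμ hadd₁ hadd₂ halt (x + y)
  simp only [map_add, AddMonoidHom.add_apply, weilPairingHom_self W n e hμ hadd₁ hadd₂ halt, hx y,
    zero_add, add_zero] at h
  exact h

end Main

end Summit.BirchSwinnertonDyer.Rank1Residual.X11b.TameCup

end
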